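import Literature.NumberTheory.Transcendental.RoySmallValueStepsGlue
import Mathlib.Analysis.SpecialFunctions.Log.Basic
import Mathlib.Analysis.SpecialFunctions.Exp
import HarnessLib

/-!
# Roy's small value estimate for `𝔾ₐ × 𝔾ₘ` — the bookkeeping of §7, Step 4, assembled

Topic `Literature/NumberTheory/Transcendental`. Part of the formalisation of the proof of Roy 2013,
Theorem 1.1 (named fact `roy2013_thm_1_1`, `RoySmallValueEstimates.lean`), seat B. Source: D. Roy,
*A small value estimate for `𝔾ₐ × 𝔾ₘ`*, Mathematika 59 (2013) 333–363 = arXiv:1301.0663, §7,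
Step 4 (p. 19 of the arXiv text):

> Proposition 2.4 gives `0 ≤ 7 log(3) D* deg(Z) + D* h(Z) + ∑_{α∈Z} log|P*(α)|`. Moreover, the
> fact that `P* ∈ 𝒞_{D*}` leads to the crude estimate `max_α log|P*(α)| ≤ [...] ≤ 4(D*)^β`.
> Combining [...] `∑_{α∈Z} min{0, log|P*(α)|} ≥ −5(D*)^β deg(Z) − D* h(Z)` (7.1). [...]
> Proposition 4.5 provides the more precise estimate
> `|P*(α)| ≤ c₄ max_{i<T*} |𝒟ⁱP*(1,γ)| + c₄^{D*} ‖P*‖ (dist(α,(1:γ))^{T*} + dist(α, A_γ))`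
> [...] thus `|P*(α)| ≥ 2c₄e^{−(D*)^ν/2}`, and so
> `log|P*(α)| ≤ 3(D*)^β + max{T* log dist(α,(1:γ)), log dist(α,A_γ)}` [...] for any subset `𝒮`
> of `𝒰`, we have `∑_{α∈𝒮} max{…} ≥ −8(D*)^β deg(Z) − D* h(Z)`.

`step4_sum_max_ge` is exactly this chain with symbolic constants: from the orbit Liouville
inequality `0 ≤ Dh + ∑_{j∈O} log yⱼ` (`yⱼ = |P*(αⱼ)| > 0`, `RoySmallValueOrbitLiouville`), the crude
bound `log yⱼ ≤ C₂`, the estimate of Prop. 4.5 (the tree's `prop_4_2`)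
`yⱼ ≤ cB + M(pⱼ^{T*} + qⱼ)` on `𝒮 ⊆ O`, and the largeness condition `log(2cB) < −(Dh + #O·C₂)`,
one gets `∑_{j∈𝒮} max{T* log pⱼ, log qⱼ} ≥ −(Dh + #O·C₂ + #𝒮·log(4M))`. It is assembled from the
lemmas of `RoySmallValueStepsGlue`. Everything is proved; no definitions, no named facts.

## References

* [Roy2013] D. Roy, *A small value estimate for 𝔾ₐ × 𝔾ₘ*, Mathematika 59 (2013), 333–363
  (arXiv:1301.0663), §7, Step 4.
-/

noncomputable section

open Finset

namespace Literature.NumberTheory.Transcendental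

namespace Roy2013

variable {ι : Type*}

/-- A single term dominates the sum of the negative parts. [folklore] -/
theorem sum_min_zero_le_self {O : Finset ι} (x : ι → ℝ) {j : ι} (hj : j ∈ O) :
    ∑ i ∈ O, min 0 (x i) ≤ x j := by
  classical
  have h := sum_min_zero_subset_le (singleton_subset_iff.mpr hj) x
  rwa [sum_singleton] at h

/-- **Roy 2013, §7, Step 4, assembled.** With `yⱼ = |P*(αⱼ)| > 0` on the orbit `O`,
`pⱼ = dist(αⱼ,(1:γ))`, `qⱼ = dist(αⱼ, A_γ)`: if `0 ≤ Dh + ∑_O log yⱼ` (Liouville),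
`log yⱼ ≤ C₂` on `O` (`C₂ ≥ 0`), `yⱼ ≤ cB + M(pⱼ^T + qⱼ)` on `𝒮 ⊆ O` (Prop. 4.5) and
`log(2cB) < −(Dh + #O C₂)` (largeness of `D*`), then
`∑_{j∈𝒮} max{T log pⱼ, log qⱼ} ≥ −(Dh + #O C₂ + #𝒮 log(4M))`. [cite: Roy2013, §7, Step 4] -/
theorem step4_sum_max_ge {O S : Finset ι} (hSO : S ⊆ O) (y p q : ι → ℝ) {Dh C₂ c B M : ℝ}
    (T : ℕ) (hy : ∀ j ∈ O, 0 < y j) (hL : 0 ≤ Dh + ∑ j ∈ O, Real.log (y j))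
    (hC : ∀ j ∈ O, Real.log (y j) ≤ C₂) (hC₂ : 0 ≤ C₂) (hcB : 0 < c * B) (hM : 0 < M)
    (hp : ∀ j ∈ S, 0 < p j) (hq : ∀ j ∈ S, 0 < q j)
    (hval : ∀ j ∈ S, y j ≤ c * B + M * (p j ^ T + q j))
    (hbig : Real.log (2 * (c * B)) < -(Dh + #O * C₂)) :
    -(Dh + #O * C₂ + #S * Real.log (4 * M)) ≤
      ∑ j ∈ S, max (T * Real.log (p j)) (Real.log (q j)) := by
  -- (7.1)
  have h71 : -(Dh + #O * C₂) ≤ ∑ j ∈ O, min 0 (Real.log (y j)) :=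
    sum_min_zero_ge O (fun j => Real.log (y j)) hC₂ hL hC
  -- per point of `S`
  have hpt : ∀ j ∈ S, Real.log (y j) - Real.log (4 * M) ≤
      max (T * Real.log (p j)) (Real.log (q j)) := by
    intro j hj
    have hjO := hSO hj
    -- `y j ≥ 2 c B`
    have hlow : -(Dh + #O * C₂) ≤ Real.log (y j) :=
      h71.trans (sum_min_zero_le_self (fun i => Real.log (y i)) hjO)
    have h2 : 2 * (c * B) ≤ y j := by
      have : Real.log (2 * (c * B)) < Real.log (y j) := lt_of_lt_of_le hbig hlow
      exact (Real.log_lt_log_iff (by linarith) (hy j hjO)).mp this |>.le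
    have h3 := le_two_mul_of_le_add (hval j hj) h2
    have h4 := log_le_log_four_mul_add_max (hy j hjO) hM (hp j hj) (hq j hj) h3
    linarith
  exact sum_max_ge_of_pointwise hSO (fun j => Real.log (y j))
    (fun j => max (T * Real.log (p j)) (Real.log (q j))) h71 hpt

end Roy2013

end Literature.NumberTheory.Transcendental
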